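import Summits.ValiantsHypothesis.ValiantsHypothesis.Theorems.LacunarySymmetroidMatrixDescartesPivotRankOneReduction
import Summits.ValiantsHypothesis.ValiantsHypothesis.Theorems.LacunarySymmetroidMatrixDescartesCensusSignVariationsWindow

/-!
# `MatrixDescartes` census — rank-one `(2,4)₁`, ONE letter below / THREE above the pivot: `Z₊ ≤ 7` outside ONE chamber (C)
# (the companion split of `…PivotRankOneReduction`; together they locate the open part of «rank-one (2,4)₁ ≤ 8» exactly)

HONEST FRAMING.  Object-search cell `pub-symmetroid`, seat `val-sym-mdr-p1` (generation 13); helper file `--supports` the crux item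
stmt-ValiantsHypothesis-18050 (`Theses.LacunarySymmetroid.MatrixDescartes`, OPEN, on HOLD) with NO closure claim.  `…PivotRankOneReduction`
treated two letters on each side of the pivot (`Z₊ ≤ 8` outside the interleaving chambers (A), (B), Descartes `10` inside).  THIS FILE: the
split `d₀ < e < d₁ < d₂ < d₃` (and, by `X ↦ 1/X`, its mirror).  Here the lowest degree `e + d₀` carries the NEGATIVE coefficient
`w₀ m(J,v₀)` alone and the highest degree `d₂ + d₃` a non-negative one, so the Descartes count is ODD: at most `9`, and `9` needs perfect
interleaving of the five pivot-type degrees `e+d₀ < 2e < e+d₁ < e+d₂ < e+d₃` with the six pair degrees, which happens in exactly ONE of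
the 25 orders — chamber (C) `s₀ p₀₁ c p₀₂ s₁ p₀₃ s₂ p₁₂ s₃ p₁₃ p₂₃`, i.e. `d₀+d₁ < 2e < d₀+d₂ < e+d₁ < d₀+d₃ < e+d₂`, `d₁+d₂ < e+d₃`
(`gap_of_not_chamberC`, linear arithmetic; located cross-check of the 25 orders in the seat's memo).  Everywhere else one gap between
consecutive pivot-type degrees is free of pair degrees and the two-ended window count (`Census.signVariations_window_two_ended`, with the
negative lowest end) gives **`Z₊ ≤ 7`** (`elevenNomial_le_seven_of_gap_oneThree`, matrix form `rankOne_posRoots_le_seven_of_not_chamberC`;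
`J` any real `2 × 2`, `w₀ > 0`, other weights `≥ 0`, the below-pivot letter core).  READING: the rank-one law «`(2,4)₁ ≤ 8`» is OPEN
EXACTLY in chambers (A), (B) (two / two; Descartes `10`) and (C), mirror-(C) (one / three; Descartes-with-parity `9`); located (seat, hub
floats): every sampled configuration in (B) and in (C) satisfies one of the weight-free kill-seven conditions of `…PivotTwoDirectionsBlockLaw`'s
engine (no exception in `8·10⁴` adversarial samples) — a covering theorem, not a new idea, is what is missing.  Nothing here bears on
`MatrixDescartes` in its window, on `DoorA26` / `DoorA34`, registers / credences, or `VP ≠ VNP`.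

[folklore] Descartes bookkeeping; tree lemmas named above.  No definitions, no named facts.
-/

-- `Summit.ValiantsHypothesis.ValiantsHypothesis.…` repeats a component by the D-0017 layout
-- (single-conjunct summit), which the `dupNamespace` linter flags; the name is mandated.
set_option linter.dupNamespace false

namespace Summit.ValiantsHypothesis.ValiantsHypothesis.Theorems.LacunarySymmetroidMatrixDescartes.Pivot.RankOneReduction

open Polynomial Matrix Finset
open scoped BigOperators

/-- In the split `d₀ < e < d₁ < d₂ < d₃` (ONE letter below the pivot) the lowest degree of the eleven-nomial is `e + d₀`, carried by the
single term of letter `0` alone: the trailing coefficient is `c₁` (position `1`). -/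
theorem trailingCoeff_elevenNomial_oneThree (e d₀ d₁ d₂ d₃ : ℕ) (h0e : d₀ < e) (he1 : e < d₁) (h12 : d₁ < d₂) (h23 : d₂ < d₃)
    (cv : Fin 11 → ℝ) (h1 : cv 1 ≠ 0) :
    (∑ i : Fin 11, Polynomial.C (cv i) * X ^ ((![2 * e, e + d₀, e + d₁, e + d₂, e + d₃, d₀ + d₁, d₀ + d₂, d₀ + d₃, d₁ + d₂, d₁ + d₃, d₂ + d₃] : Fin 11 → ℕ) i)).trailingCoeff = cv 1 := by
  set f := (∑ i : Fin 11, Polynomial.C (cv i) * X ^ ((![2 * e, e + d₀, e + d₁, e + d₂, e + d₃, d₀ + d₁, d₀ + d₂, d₀ + d₃, d₁ + d₂, d₁ + d₃, d₂ + d₃] : Fin 11 → ℕ) i)) with hf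
  have hcoef : f.coeff (e + d₀) = cv 1 := by
    rw [hf, coeff_elevenNomial, Finset.sum_eq_single (1 : Fin 11)]
    · simp
    · intro i _ hi
      fin_cases i <;> simp at hi ⊢ <;> omega
    · simp
  have hne : f ≠ 0 := fun h0 => by
    have := hcoef; rw [h0, coeff_zero] at this; exact h1 this.symm
  have hge : e + d₀ ≤ f.natTrailingDegree := by
    refine le_natTrailingDegree hne fun m hm => ?_
    rw [hf, coeff_elevenNomial]
    refine Finset.sum_eq_zero fun i _ => ?_
    rw [if_neg]
    fin_cases i <;> simp <;> omega
  have hle : f.natTrailingDegree ≤ e + d₀ := natTrailingDegree_le_of_ne_zero (by rw [hcoef]; exact h1)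
  change f.coeff f.natTrailingDegree = cv 1
  rw [le_antisymm hle hge, hcoef]

/-- **ONE LETTER BELOW, THREE ABOVE (real-parameter form): `Z₊ ≤ 7` off chamber (C), `Z₊ ≤ 9` always.**  The eleven-nomial with
`d₀ < e < d₁ < d₂ < d₃`, non-negative pair coefficients and a NEGATIVE coefficient at the lowest degree `e + d₀` (the below-pivot letter
core): if one of the four gaps between the consecutive pivot-type degrees `e+d₀ < 2e < e+d₁ < e+d₂ < e+d₃` carries no pair degree
(`G1`–`G4`), then `Z₊ ≤ 7`. -/
theorem elevenNomial_le_seven_of_gap_oneThree (e d₀ d₁ d₂ d₃ : ℕ) (h0e : d₀ < e) (he1 : e < d₁) (h12 : d₁ < d₂) (h23 : d₂ < d₃)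
    (hgap : (2 * e ≤ d₀ + d₁)
      ∨ (d₀ + d₁ ≤ 2 * e ∧ ¬ (2 * e < d₀ + d₂ ∧ d₀ + d₂ < e + d₁) ∧ ¬ (2 * e < d₀ + d₃ ∧ d₀ + d₃ < e + d₁))
      ∨ (d₀ + d₂ ≤ e + d₁ ∧ ¬ (e + d₁ < d₀ + d₃ ∧ d₀ + d₃ < e + d₂))
      ∨ (d₀ + d₃ ≤ e + d₂ ∧ e + d₃ ≤ d₁ + d₂))
    (cv : Fin 11 → ℝ) (hpos : ∀ i : Fin 11, 5 ≤ (i : ℕ) → 0 ≤ cv i) (h1 : cv 1 < 0) :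
    ((∑ i : Fin 11, Polynomial.C (cv i) * X ^ ((![2 * e, e + d₀, e + d₁, e + d₂, e + d₃, d₀ + d₁, d₀ + d₂, d₀ + d₃, d₁ + d₂, d₁ + d₃, d₂ + d₃] : Fin 11 → ℕ) i)).roots.toFinset.filter (fun t => 0 < t)).card ≤ 7 := by
  classical
  set f := (∑ i : Fin 11, Polynomial.C (cv i) * X ^ ((![2 * e, e + d₀, e + d₁, e + d₂, e + d₃, d₀ + d₁, d₀ + d₂, d₀ + d₃, d₁ + d₂, d₁ + d₃, d₂ + d₃] : Fin 11 → ℕ) i)) with hf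
  have htrail : f.trailingCoeff < 0 := by
    rw [hf, trailingCoeff_elevenNomial_oneThree e d₀ d₁ d₂ d₃ h0e he1 h12 h23 cv h1.ne]; exact h1
  have hneg : ∀ m, f.coeff m < 0 → m = 2 * e ∨ m = e + d₀ ∨ m = e + d₁ ∨ m = e + d₂ ∨ m = e + d₃ :=
    fun m hm => eq_pivotDegree_of_coeff_neg e d₀ d₁ d₂ d₃ cv hpos m hm
  have hZ := Census.card_posRoots_le_signVariations f
  have hb := Census.signVariations_two_ended_le f
  rw [if_pos htrail] at hb
  -- Step 1: a non-negative pivot-type coefficient ⇒ at most four negative coefficients ⇒ `Var + 1 ≤ 8`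
  have step1 : ∀ m₀, (m₀ = 2 * e ∨ m₀ = e + d₀ ∨ m₀ = e + d₁ ∨ m₀ = e + d₂ ∨ m₀ = e + d₃) → 0 ≤ f.coeff m₀ →
      (f.roots.toFinset.filter (fun t => 0 < t)).card ≤ 7 := by
    intro m₀ hm₀ h0
    set S : Finset ℕ := {2 * e, e + d₀, e + d₁, e + d₂, e + d₃} with hS
    have hsub : Pivot.TwoDescartes.negSupp f ⊆ S.erase m₀ := by
      intro n hn
      simp only [Pivot.TwoDescartes.negSupp, Finset.mem_filter] at hn
      refine Finset.mem_erase.mpr ⟨fun h => ?_, ?_⟩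
      · rw [h] at hn; exact absurd hn.2 (not_lt.mpr h0)
      · have := hneg n hn.2; simp only [hS, Finset.mem_insert, Finset.mem_singleton]; omega
    have hm₀S : m₀ ∈ S := by simp only [hS, Finset.mem_insert, Finset.mem_singleton]; omega
    have hc := Finset.card_le_card hsub
    rw [Finset.card_erase_of_mem hm₀S] at hc
    have : S.card ≤ 5 := Finset.card_le_five
    split_ifs at hb <;> omega
  by_cases hc : 0 ≤ f.coeff (2 * e)
  · exact step1 _ (by omega) hc
  by_cases ha : 0 ≤ f.coeff (e + d₁)
  · exact step1 _ (by omega) ha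
  by_cases hb2 : 0 ≤ f.coeff (e + d₂)
  · exact step1 _ (by omega) hb2
  by_cases hd : 0 ≤ f.coeff (e + d₃)
  · exact step1 _ (by omega) hd
  push Not at hc ha hb2 hd
  have h0 : f.coeff (e + d₀) < 0 := by
    -- the coefficient at `e + d₀` is `cv 1`
    have : f.coeff (e + d₀) = cv 1 := by
      rw [hf, coeff_elevenNomial, Finset.sum_eq_single (1 : Fin 11)]
      · simp
      · intro i _ hi
        fin_cases i <;> simp at hi ⊢ <;> omega
      · simp
    rw [this]; exact h1
  have hzero : ∀ m, (∀ i : Fin 11, m ≠ (![2 * e, e + d₀, e + d₁, e + d₂, e + d₃, d₀ + d₁, d₀ + d₂, d₀ + d₃, d₁ + d₂, d₁ + d₃, d₂ + d₃] : Fin 11 → ℕ) i) →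
      f.coeff m ≤ 0 := by
    intro m hm
    rw [hf, coeff_elevenNomial]
    refine Finset.sum_nonpos fun i _ => ?_
    rw [if_neg (hm i)]
  rcases hgap with g | g | g | g
  · have hw := Census.signVariations_window_two_ended f (e + d₀) (2 * e) (by omega) (fun m hx hy => by
      rcases Nat.eq_or_lt_of_le hx with h | h
      · rw [← h]; exact h0.le
      rcases Nat.eq_or_lt_of_le hy with h' | h'
      · rw [h']; exact hc.le
      exact hzero m (fun i => by fin_cases i <;> simp <;> omega)) {e + d₁, e + d₂, e + d₃}
      (fun m hm hout => by have := hneg m hm; simp only [Finset.mem_insert, Finset.mem_singleton]; omega)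
    rw [if_pos htrail] at hw
    have : ({e + d₁, e + d₂, e + d₃} : Finset ℕ).card ≤ 3 := Finset.card_le_three
    split_ifs at hw <;> omega
  · have hw := Census.signVariations_window_two_ended f (2 * e) (e + d₁) (by omega) (fun m hx hy => by
      rcases Nat.eq_or_lt_of_le hx with h | h
      · rw [← h]; exact hc.le
      rcases Nat.eq_or_lt_of_le hy with h' | h'
      · rw [h']; exact ha.le
      exact hzero m (fun i => by fin_cases i <;> simp <;> omega)) {e + d₀, e + d₂, e + d₃}
      (fun m hm hout => by have := hneg m hm; simp only [Finset.mem_insert, Finset.mem_singleton]; omega)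
    rw [if_pos htrail] at hw
    have : ({e + d₀, e + d₂, e + d₃} : Finset ℕ).card ≤ 3 := Finset.card_le_three
    split_ifs at hw <;> omega
  · have hw := Census.signVariations_window_two_ended f (e + d₁) (e + d₂) (by omega) (fun m hx hy => by
      rcases Nat.eq_or_lt_of_le hx with h | h
      · rw [← h]; exact ha.le
      rcases Nat.eq_or_lt_of_le hy with h' | h'
      · rw [h']; exact hb2.le
      exact hzero m (fun i => by fin_cases i <;> simp <;> omega)) {2 * e, e + d₀, e + d₃}
      (fun m hm hout => by have := hneg m hm; simp only [Finset.mem_insert, Finset.mem_singleton]; omega)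
    rw [if_pos htrail] at hw
    have : ({2 * e, e + d₀, e + d₃} : Finset ℕ).card ≤ 3 := Finset.card_le_three
    split_ifs at hw <;> omega
  · have hw := Census.signVariations_window_two_ended f (e + d₂) (e + d₃) (by omega) (fun m hx hy => by
      rcases Nat.eq_or_lt_of_le hx with h | h
      · rw [← h]; exact hb2.le
      rcases Nat.eq_or_lt_of_le hy with h' | h'
      · rw [h']; exact hd.le
      exact hzero m (fun i => by fin_cases i <;> simp <;> omega)) {2 * e, e + d₀, e + d₁}
      (fun m hm hout => by have := hneg m hm; simp only [Finset.mem_insert, Finset.mem_singleton]; omega)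
    rw [if_pos htrail] at hw
    have : ({2 * e, e + d₀, e + d₁} : Finset ℕ).card ≤ 3 := Finset.card_le_three
    split_ifs at hw <;> omega

/-- **Outside chamber (C) one of the four gaps is empty.**  For one letter below and three above the pivot the eleven degrees admit 25
orders; the Descartes count reaches `9` (it is odd: the ends have opposite signs) in exactly ONE of them, chamber (C)
`s₀ p₀₁ c p₀₂ s₁ p₀₃ s₂ p₁₂ s₃ p₁₃ p₂₃`, i.e. `d₀+d₁ < 2e < d₀+d₂ < e+d₁ < d₀+d₃ < e+d₂` and `d₁+d₂ < e+d₃`. [linear arithmetic] -/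
theorem gap_of_not_chamberC (e d₀ d₁ d₂ d₃ : ℕ)
    (hC : ¬ (d₀ + d₁ < 2 * e ∧ 2 * e < d₀ + d₂ ∧ d₀ + d₂ < e + d₁ ∧ e + d₁ < d₀ + d₃ ∧ d₀ + d₃ < e + d₂ ∧ d₁ + d₂ < e + d₃)) :
    (2 * e ≤ d₀ + d₁)
      ∨ (d₀ + d₁ ≤ 2 * e ∧ ¬ (2 * e < d₀ + d₂ ∧ d₀ + d₂ < e + d₁) ∧ ¬ (2 * e < d₀ + d₃ ∧ d₀ + d₃ < e + d₁))
      ∨ (d₀ + d₂ ≤ e + d₁ ∧ ¬ (e + d₁ < d₀ + d₃ ∧ d₀ + d₃ < e + d₂))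
      ∨ (d₀ + d₃ ≤ e + d₂ ∧ e + d₃ ≤ d₁ + d₂) := by
  omega

/-- **RANK-ONE `(2,4)₁`, ONE LETTER BELOW / THREE ABOVE: `Z₊ ≤ 7` OUTSIDE CHAMBER (C)** (matrix form).  `F = X^e J + ∑ₖ wₖ X^{dₖ} vₖvₖᵀ`,
`d₀ < e < d₁ < d₂ < d₃`, `J` ANY real `2 × 2` matrix, `w₀ > 0`, `w₁, w₂, w₃ ≥ 0`, the below-pivot letter core (`m(J,v₀) < 0`): unless the
exponents lie in the open chamber (C), `det F` has at most SEVEN distinct positive roots (in (C) Descartes-with-parity allows `9`: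
`TwoGap.posRoots_two_ended_le`).  Mirror (three below / one above) by `X ↦ 1/X`.  With `…PivotRankOneReduction` (two / two: `≤ 8` off
chambers (A), (B)) this locates the open part of «rank-one `(2,4)₁ ≤ 8`» exactly: chambers (A), (B), (C) and the mirror of (C).
[this file] -/
theorem rankOne_posRoots_le_seven_of_not_chamberC (e d₀ d₁ d₂ d₃ : ℕ) (h0e : d₀ < e) (he1 : e < d₁) (h12 : d₁ < d₂)
    (h23 : d₂ < d₃)
    (hC : ¬ (d₀ + d₁ < 2 * e ∧ 2 * e < d₀ + d₂ ∧ d₀ + d₂ < e + d₁ ∧ e + d₁ < d₀ + d₃ ∧ d₀ + d₃ < e + d₂ ∧ d₁ + d₂ < e + d₃))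
    (J : Matrix (Fin 2) (Fin 2) ℝ) (v₀ v₁ v₂ v₃ : Fin 2 → ℝ) (w₀ w₁ w₂ w₃ : ℝ) (hw₀ : 0 < w₀) (hw₁ : 0 ≤ w₁) (hw₂ : 0 ≤ w₂)
    (hw₃ : 0 ≤ w₃) (hm₀ : J 0 0 * v₀ 1 ^ 2 + J 1 1 * v₀ 0 ^ 2 - (J 0 1 + J 1 0) * (v₀ 0 * v₀ 1) < 0) :
    ((Matrix.det (((X : ℝ[X]) ^ e) • J.map Polynomial.C
        + (Polynomial.C w₀ * X ^ d₀) • (vecMulVec v₀ v₀).map Polynomial.C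
        + (Polynomial.C w₁ * X ^ d₁) • (vecMulVec v₁ v₁).map Polynomial.C
        + (Polynomial.C w₂ * X ^ d₂) • (vecMulVec v₂ v₂).map Polynomial.C
        + (Polynomial.C w₃ * X ^ d₃) • (vecMulVec v₃ v₃).map Polynomial.C)).roots.toFinset.filter (fun t => 0 < t)).card
      ≤ 7 := by
  rw [TwoDirections.BlockLaw.det_rankOne_four_sum]
  exact elevenNomial_le_seven_of_gap_oneThree e d₀ d₁ d₂ d₃ h0e he1 h12 h23 (gap_of_not_chamberC e d₀ d₁ d₂ d₃ hC) _
    (fun i hi => by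
      fin_cases i <;> simp at hi ⊢ <;> positivity)
    (by simpa using mul_neg_of_pos_of_neg hw₀ hm₀)

/-! ## The mirror split: THREE letters below / ONE above (`d₀ < d₁ < d₂ < e < d₃`) -/

/-- In the split `d₀ < d₁ < d₂ < e < d₃` the highest degree of the eleven-nomial is `e + d₃`, carried by the single term of letter `3`
alone: the leading coefficient is `c₄` (position `4`). -/
theorem leadingCoeff_elevenNomial_threeOne (e d₀ d₁ d₂ d₃ : ℕ) (h01 : d₀ < d₁) (h12 : d₁ < d₂) (h2e : d₂ < e) (he3 : e < d₃)
    (cv : Fin 11 → ℝ) (h4 : cv 4 ≠ 0) : (∑ i : Fin 11, Polynomial.C (cv i) * X ^ ((![2 * e, e + d₀, e + d₁, e + d₂, e + d₃, d₀ + d₁, d₀ + d₂, d₀ + d₃, d₁ + d₂, d₁ + d₃, d₂ + d₃] : Fin 11 → ℕ) i)).leadingCoeff = cv 4 := by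
  set f := (∑ i : Fin 11, Polynomial.C (cv i) * X ^ ((![2 * e, e + d₀, e + d₁, e + d₂, e + d₃, d₀ + d₁, d₀ + d₂, d₀ + d₃, d₁ + d₂, d₁ + d₃, d₂ + d₃] : Fin 11 → ℕ) i)) with hf
  have hcoef : f.coeff (e + d₃) = cv 4 := by
    rw [hf, coeff_elevenNomial, Finset.sum_eq_single (4 : Fin 11)]
    · simp
    · intro i _ hi
      fin_cases i <;> simp at hi ⊢ <;> omega
    · simp
  have hle : f.natDegree ≤ e + d₃ := by
    rw [hf]
    refine natDegree_sum_le_of_forall_le _ _ fun i _ => (natDegree_C_mul_X_pow_le _ _).trans ?_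
    fin_cases i <;> simp <;> omega
  have hdeg : f.natDegree = e + d₃ := natDegree_eq_of_le_of_coeff_ne_zero hle (by rw [hcoef]; exact h4)
  change f.coeff f.natDegree = cv 4
  rw [hdeg, hcoef]

/-- **THREE BELOW / ONE ABOVE (real-parameter form): `Z₊ ≤ 7` off the mirror chamber (C′).**  Non-negative pair coefficients, a NEGATIVE
coefficient at the highest degree `e + d₃` (the above-pivot letter core), and one of the four gaps between the consecutive pivot-type
degrees `e+d₀ < e+d₁ < e+d₂ < 2e < e+d₃` free of pair degrees. -/
theorem elevenNomial_le_seven_of_gap_threeOne (e d₀ d₁ d₂ d₃ : ℕ) (h01 : d₀ < d₁) (h12 : d₁ < d₂) (h2e : d₂ < e) (he3 : e < d₃)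
    (hgap : (d₁ + d₂ ≤ e + d₀ ∧ e + d₁ ≤ d₀ + d₃)
      ∨ (¬ (e + d₁ < d₀ + d₃ ∧ d₀ + d₃ < e + d₂) ∧ e + d₂ ≤ d₁ + d₃)
      ∨ (¬ (e + d₂ < d₀ + d₃ ∧ d₀ + d₃ < 2 * e) ∧ ¬ (e + d₂ < d₁ + d₃ ∧ d₁ + d₃ < 2 * e) ∧ 2 * e ≤ d₂ + d₃)
      ∨ (d₂ + d₃ ≤ 2 * e))
    (cv : Fin 11 → ℝ) (hpos : ∀ i : Fin 11, 5 ≤ (i : ℕ) → 0 ≤ cv i) (h4 : cv 4 < 0) :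
    ((∑ i : Fin 11, Polynomial.C (cv i) * X ^ ((![2 * e, e + d₀, e + d₁, e + d₂, e + d₃, d₀ + d₁, d₀ + d₂, d₀ + d₃, d₁ + d₂, d₁ + d₃, d₂ + d₃] : Fin 11 → ℕ) i)).roots.toFinset.filter (fun t => 0 < t)).card ≤ 7 := by
  classical
  set f := (∑ i : Fin 11, Polynomial.C (cv i) * X ^ ((![2 * e, e + d₀, e + d₁, e + d₂, e + d₃, d₀ + d₁, d₀ + d₂, d₀ + d₃, d₁ + d₂, d₁ + d₃, d₂ + d₃] : Fin 11 → ℕ) i)) with hf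
  have hlead : f.leadingCoeff < 0 := by
    rw [hf, leadingCoeff_elevenNomial_threeOne e d₀ d₁ d₂ d₃ h01 h12 h2e he3 cv h4.ne]; exact h4
  have hneg : ∀ m, f.coeff m < 0 → m = 2 * e ∨ m = e + d₀ ∨ m = e + d₁ ∨ m = e + d₂ ∨ m = e + d₃ :=
    fun m hm => eq_pivotDegree_of_coeff_neg e d₀ d₁ d₂ d₃ cv hpos m hm
  have hZ := Census.card_posRoots_le_signVariations f
  have hb := Census.signVariations_two_ended_le f
  rw [if_pos hlead] at hb
  have step1 : ∀ m₀, (m₀ = 2 * e ∨ m₀ = e + d₀ ∨ m₀ = e + d₁ ∨ m₀ = e + d₂ ∨ m₀ = e + d₃) → 0 ≤ f.coeff m₀ →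
      (f.roots.toFinset.filter (fun t => 0 < t)).card ≤ 7 := by
    intro m₀ hm₀ h0
    set S : Finset ℕ := {2 * e, e + d₀, e + d₁, e + d₂, e + d₃} with hS
    have hsub : Pivot.TwoDescartes.negSupp f ⊆ S.erase m₀ := by
      intro n hn
      simp only [Pivot.TwoDescartes.negSupp, Finset.mem_filter] at hn
      refine Finset.mem_erase.mpr ⟨fun h => ?_, ?_⟩
      · rw [h] at hn; exact absurd hn.2 (not_lt.mpr h0)
      · have := hneg n hn.2; simp only [hS, Finset.mem_insert, Finset.mem_singleton]; omega
    have hm₀S : m₀ ∈ S := by simp only [hS, Finset.mem_insert, Finset.mem_singleton]; omega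
    have hc := Finset.card_le_card hsub
    rw [Finset.card_erase_of_mem hm₀S] at hc
    have : S.card ≤ 5 := Finset.card_le_five
    split_ifs at hb <;> omega
  by_cases hc : 0 ≤ f.coeff (2 * e)
  · exact step1 _ (by omega) hc
  by_cases h0 : 0 ≤ f.coeff (e + d₀)
  · exact step1 _ (by omega) h0
  by_cases ha : 0 ≤ f.coeff (e + d₁)
  · exact step1 _ (by omega) ha
  by_cases hb2 : 0 ≤ f.coeff (e + d₂)
  · exact step1 _ (by omega) hb2
  push Not at hc h0 ha hb2
  have h3 : f.coeff (e + d₃) < 0 := by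
    have : f.coeff (e + d₃) = cv 4 := by
      rw [hf, coeff_elevenNomial, Finset.sum_eq_single (4 : Fin 11)]
      · simp
      · intro i _ hi
        fin_cases i <;> simp at hi ⊢ <;> omega
      · simp
    rw [this]; exact h4
  have hzero : ∀ m, (∀ i : Fin 11, m ≠ (![2 * e, e + d₀, e + d₁, e + d₂, e + d₃, d₀ + d₁, d₀ + d₂, d₀ + d₃, d₁ + d₂, d₁ + d₃, d₂ + d₃] : Fin 11 → ℕ) i) → f.coeff m ≤ 0 := by
    intro m hm
    rw [hf, coeff_elevenNomial]
    refine Finset.sum_nonpos fun i _ => ?_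
    rw [if_neg (hm i)]
  rcases hgap with g | g | g | g
  · have hw := Census.signVariations_window_two_ended f (e + d₀) (e + d₁) (by omega) (fun m hx hy => by
      rcases Nat.eq_or_lt_of_le hx with h | h
      · rw [← h]; exact h0.le
      rcases Nat.eq_or_lt_of_le hy with h' | h'
      · rw [h']; exact ha.le
      exact hzero m (fun i => by fin_cases i <;> simp <;> omega)) {2 * e, e + d₂, e + d₃}
      (fun m hm hout => by have := hneg m hm; simp only [Finset.mem_insert, Finset.mem_singleton]; omega)
    rw [if_pos hlead] at hw
    have : ({2 * e, e + d₂, e + d₃} : Finset ℕ).card ≤ 3 := Finset.card_le_three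
    split_ifs at hw <;> omega
  · have hw := Census.signVariations_window_two_ended f (e + d₁) (e + d₂) (by omega) (fun m hx hy => by
      rcases Nat.eq_or_lt_of_le hx with h | h
      · rw [← h]; exact ha.le
      rcases Nat.eq_or_lt_of_le hy with h' | h'
      · rw [h']; exact hb2.le
      exact hzero m (fun i => by fin_cases i <;> simp <;> omega)) {2 * e, e + d₀, e + d₃}
      (fun m hm hout => by have := hneg m hm; simp only [Finset.mem_insert, Finset.mem_singleton]; omega)
    rw [if_pos hlead] at hw
    have : ({2 * e, e + d₀, e + d₃} : Finset ℕ).card ≤ 3 := Finset.card_le_three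
    split_ifs at hw <;> omega
  · have hw := Census.signVariations_window_two_ended f (e + d₂) (2 * e) (by omega) (fun m hx hy => by
      rcases Nat.eq_or_lt_of_le hx with h | h
      · rw [← h]; exact hb2.le
      rcases Nat.eq_or_lt_of_le hy with h' | h'
      · rw [h']; exact hc.le
      exact hzero m (fun i => by fin_cases i <;> simp <;> omega)) {e + d₀, e + d₁, e + d₃}
      (fun m hm hout => by have := hneg m hm; simp only [Finset.mem_insert, Finset.mem_singleton]; omega)
    rw [if_pos hlead] at hw
    have : ({e + d₀, e + d₁, e + d₃} : Finset ℕ).card ≤ 3 := Finset.card_le_three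
    split_ifs at hw <;> omega
  · have hw := Census.signVariations_window_two_ended f (2 * e) (e + d₃) (by omega) (fun m hx hy => by
      rcases Nat.eq_or_lt_of_le hx with h | h
      · rw [← h]; exact hc.le
      rcases Nat.eq_or_lt_of_le hy with h' | h'
      · rw [h']; exact h3.le
      exact hzero m (fun i => by fin_cases i <;> simp <;> omega)) {e + d₀, e + d₁, e + d₂}
      (fun m hm hout => by have := hneg m hm; simp only [Finset.mem_insert, Finset.mem_singleton]; omega)
    rw [if_pos hlead] at hw
    have : ({e + d₀, e + d₁, e + d₂} : Finset ℕ).card ≤ 3 := Finset.card_le_three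
    split_ifs at hw <;> omega

/-- **Outside the mirror chamber (C′) one of the four gaps is empty** (`C′`: `e+d₀ < d₁+d₂`, `e+d₁ < d₀+d₃ < e+d₂ < d₁+d₃ < 2e < d₂+d₃`,
the order `p₀₁ p₀₂ s₀ p₁₂ s₁ p₀₃ s₂ p₁₃ c p₂₃ s₃`). [linear arithmetic] -/
theorem gap_of_not_chamberC' (e d₀ d₁ d₂ d₃ : ℕ)
    (hC : ¬ (e + d₀ < d₁ + d₂ ∧ e + d₁ < d₀ + d₃ ∧ d₀ + d₃ < e + d₂ ∧ e + d₂ < d₁ + d₃ ∧ d₁ + d₃ < 2 * e ∧ 2 * e < d₂ + d₃)) :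
    (d₁ + d₂ ≤ e + d₀ ∧ e + d₁ ≤ d₀ + d₃)
      ∨ (¬ (e + d₁ < d₀ + d₃ ∧ d₀ + d₃ < e + d₂) ∧ e + d₂ ≤ d₁ + d₃)
      ∨ (¬ (e + d₂ < d₀ + d₃ ∧ d₀ + d₃ < 2 * e) ∧ ¬ (e + d₂ < d₁ + d₃ ∧ d₁ + d₃ < 2 * e) ∧ 2 * e ≤ d₂ + d₃)
      ∨ (d₂ + d₃ ≤ 2 * e) := by
  omega

/-- **RANK-ONE `(2,4)₁`, THREE LETTERS BELOW / ONE ABOVE: `Z₊ ≤ 7` OUTSIDE THE MIRROR CHAMBER (C′)** (matrix form; `J` any real `2 × 2`,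
`w₃ > 0`, other weights `≥ 0`, the above-pivot letter core). [this file] -/
theorem rankOne_posRoots_le_seven_of_not_chamberC' (e d₀ d₁ d₂ d₃ : ℕ) (h01 : d₀ < d₁) (h12 : d₁ < d₂) (h2e : d₂ < e)
    (he3 : e < d₃)
    (hC : ¬ (e + d₀ < d₁ + d₂ ∧ e + d₁ < d₀ + d₃ ∧ d₀ + d₃ < e + d₂ ∧ e + d₂ < d₁ + d₃ ∧ d₁ + d₃ < 2 * e ∧ 2 * e < d₂ + d₃))
    (J : Matrix (Fin 2) (Fin 2) ℝ) (v₀ v₁ v₂ v₃ : Fin 2 → ℝ) (w₀ w₁ w₂ w₃ : ℝ) (hw₀ : 0 ≤ w₀) (hw₁ : 0 ≤ w₁) (hw₂ : 0 ≤ w₂)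
    (hw₃ : 0 < w₃) (hm₃ : J 0 0 * v₃ 1 ^ 2 + J 1 1 * v₃ 0 ^ 2 - (J 0 1 + J 1 0) * (v₃ 0 * v₃ 1) < 0) :
    ((Matrix.det (((X : ℝ[X]) ^ e) • J.map Polynomial.C
        + (Polynomial.C w₀ * X ^ d₀) • (vecMulVec v₀ v₀).map Polynomial.C
        + (Polynomial.C w₁ * X ^ d₁) • (vecMulVec v₁ v₁).map Polynomial.C
        + (Polynomial.C w₂ * X ^ d₂) • (vecMulVec v₂ v₂).map Polynomial.C
        + (Polynomial.C w₃ * X ^ d₃) • (vecMulVec v₃ v₃).map Polynomial.C)).roots.toFinset.filter (fun t => 0 < t)).card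
      ≤ 7 := by
  rw [TwoDirections.BlockLaw.det_rankOne_four_sum]
  exact elevenNomial_le_seven_of_gap_threeOne e d₀ d₁ d₂ d₃ h01 h12 h2e he3 (gap_of_not_chamberC' e d₀ d₁ d₂ d₃ hC) _
    (fun i hi => by
      fin_cases i <;> simp at hi ⊢ <;> positivity)
    (by simpa using mul_neg_of_pos_of_neg hw₃ hm₃)

end Summit.ValiantsHypothesis.ValiantsHypothesis.Theorems.LacunarySymmetroidMatrixDescartes.Pivot.RankOneReduction
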